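import Mathlib.Analysis.Calculus.Deriv.MeanValue
import Mathlib.Analysis.SpecialFunctions.ExpDeriv
import Mathlib.Analysis.SpecialFunctions.Trigonometric.DerivHyp
import Mathlib.MeasureTheory.Group.Integral
import Mathlib.MeasureTheory.Constructions.Pi
import Mathlib.MeasureTheory.Measure.Haar.OfBasis
import Mathlib.MeasureTheory.Measure.Haar.Unique
import HarnessLib

/-!
# Real translation of a semi-log-concave product weight: the spin-wave factor for non-Gaussian
# dual measures (Fröhlich–Spencer 1981, (6.28)–(6.29) and (6.38)–(6.39))

In the proof of the perimeter law for the four-dimensional `U(1)` lattice gauge theory with the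
WILSON action (FS82, p. 433: "an adaptation of Appendix B, Lemma 4.3 and Sect. 6 of [FS81]") — as in
FS81's treatment of the plane rotator, Sect. 6 — the Gaussian plaquette weight `e^{-φ²/2β}` of the
Villain model is replaced by an even, positive weight `W = I_β` interpolating `n ↦ I_n(β)`, and the
exact Gaussian "completion of the square" that extracts the spin-wave factor `e^{-(1/2β)(ε, ε)}`
after the real change of variables `φ → φ + θ` (FS82 (2.52)–(2.54); FS81 (6.10)–(6.16)) is replaced
by two inequalities:

* **(6.28)** ("By property (d) of `I_β` and Taylor's theorem with remainder")
  `∏_j I_β(dφ(j) + θ(j)) / I_β(dφ(j)) ≥ exp ∑_j { Ĩ_β(dφ(j)) θ(j) - C β⁻¹ |θ(j)|² }`, `Ĩ_β = (log I_β)'`,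
  which only uses the real bound `(log I_β)'' ≥ -2Cβ⁻¹`;
* **(6.29), (6.38)–(6.39)** ("By property (b) of `I_β`, `Ĩ_β` is an odd function of `φ` … Jensen's
  inequality yields"): against an EVEN positive weight the odd exponent `∑ Ĩ_β(dφ(j))θ(j)` can only
  INCREASE the integral, so that `Z'(σ) ≥ exp[-Cβ⁻¹ ‖θ‖²] · Z'(0)`-type bounds follow — the factor
  `exp[-Cβ⁻¹‖θ‖₂²]` "is the analogue of the spin wave contribution in the Villain model".

This file proves these steps for an ABSTRACT weight `W = exp ∘ ℓ` with `ℓ'' ≥ -L` (so that it applies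
to both analytic interpolations of the Bessel weights in the tree, `besselIInterp` of
`BesselIDebyeInterpolation` and `besselInterp` of `BesselSaddleInterpolation`, whose real curvature
bounds are `BesselIDebyeStrip`/`BesselSaddleCurvature.log_besselInterp_second_diff_ge`), and with the
Jensen step replaced by the sharper symmetrisation `∫ Φ e^{O} = ∫ Φ cosh O ≥ ∫ Φ` (`Φ` even, `O` odd):

* `taylor_ge_of_deriv2_ge` — `ℓ(x + θ) ≥ ℓ(x) + ℓ'(x)θ - (L/2)θ²` from `ℓ'' ≥ -L`;
* `deriv_odd_of_even` — the derivative of an even function is odd;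
* `sum_taylor_ge`, `prod_exp_translation_ge` — the product form (6.28):
  `∏_p W(x_p + θ_p) ≥ (∏_p W(x_p)) · exp(∑_p ℓ'(x_p)θ_p - (L/2)∑_p θ_p²)`;
* `integral_le_integral_mul_exp_odd` — for a negation-invariant measure, `Φ ≥ 0` even, `O` odd:
  `∫ Φ ≤ ∫ Φ e^{O}`; `integral_le_integral_mul_exp_odd_add` — with a further exponent `R ≥ -δ`:
  `e^{-δ} ∫ Φ ≤ ∫ Φ e^{O + R}` (the form consumed by FS81 (6.38)–(6.39), where `R = ∑_ρ H_{2,ρ}`);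
* `integral_mul_prod_exp_translation_ge` — the assembled **spin-wave extraction** on `ℝ^ι`: for an
  odd map `A : ℝ^ι → ℝ^P` (e.g. a linear map `x ↦ dx`), an even weight `Φ ≥ 0` and `W = exp ∘ ℓ` even
  with `ℓ'' ≥ -L`,
  `exp(-(L/2)‖θ‖²) ∫ Φ(x) ∏_p W((Ax)_p) dx ≤ ∫ Φ(x) ∏_p W((Ax)_p + θ_p) dx`.
  For the Gaussian `ℓ(t) = -t²/2β` (`L = 1/β`) and `θ = ε ⊥ range A` this is FS82's identity (2.54)
  with `≤`; for the Wilson action it is the bound FS82 p. 433 defers to FS81 Sect. 6.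

Everything is proved; no named fact is introduced.

## References

* J. Fröhlich, T. Spencer, *The Kosterlitz–Thouless transition in two-dimensional abelian spin
  systems and the Coulomb gas*, Comm. Math. Phys. 81 (1981) 527–602, Sect. 6: properties (b)–(d)
  p. 576, (6.28)–(6.29) p. 582, (6.38)–(6.39) p. 583. [FrohlichSpencerKT1981]
* J. Fröhlich, T. Spencer, *Massless phases and symmetry restoration in abelian gauge theories and
  spin systems*, Comm. Math. Phys. 83 (1982) 411–454, §2.7 (2.52)–(2.54), §2.10 (2.78)–(2.81),
  (2.88), p. 433. [FrohlichSpencerCMP1982]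
-/

noncomputable section

open MeasureTheory Finset
open scoped BigOperators

namespace Literature.Probability.LatticeModels

namespace WeightTranslation

/-! ### One variable: the semiconvex tangent bound and parity of the derivative -/

/-- **Taylor lower bound from a curvature lower bound.** If `ℓ' = ℓ₁`, `ℓ₁' = ℓ₂` and `ℓ₂ ≥ -L`
everywhere, then `ℓ(x) + ℓ₁(x)θ - (L/2)θ² ≤ ℓ(x + θ)` for all real `x, θ`
(FS81 (6.28): "Taylor's theorem with remainder"). [cite: FrohlichSpencerKT1981, Sect. 6 (6.28), p. 582] -/
theorem taylor_ge_of_deriv2_ge {ℓ ℓ₁ ℓ₂ : ℝ → ℝ} {L : ℝ}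
    (hℓ : ∀ t, HasDerivAt ℓ (ℓ₁ t) t) (hℓ₁ : ∀ t, HasDerivAt ℓ₁ (ℓ₂ t) t) (hL : ∀ t, -L ≤ ℓ₂ t)
    (x θ : ℝ) : ℓ x + ℓ₁ x * θ - L / 2 * θ ^ 2 ≤ ℓ (x + θ) := by
  -- `φ(s) = ℓ(x+s) - ℓ(x) - ℓ₁(x) s + (L/2) s²` has `φ(0) = 0`, `φ' = ψ`, `ψ(0) = 0`, `ψ' = ℓ₂(x+s) + L ≥ 0`.
  set ψ : ℝ → ℝ := fun s => ℓ₁ (x + s) - ℓ₁ x + L * s with hψ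
  set φ : ℝ → ℝ := fun s => ℓ (x + s) - ℓ x - ℓ₁ x * s + L / 2 * s ^ 2 with hφ
  have hψd : ∀ s, HasDerivAt ψ (ℓ₂ (x + s) + L) s := by
    intro s
    have h1 : HasDerivAt (fun s => ℓ₁ (x + s)) (ℓ₂ (x + s)) s := (hℓ₁ (x + s)).comp_const_add x s
    exact ((h1.sub_const (ℓ₁ x)).add ((hasDerivAt_id s).const_mul L)).congr_deriv (by simp)
  have hφd : ∀ s, HasDerivAt φ (ψ s) s := by
    intro s
    have h1 : HasDerivAt (fun s => ℓ (x + s)) (ℓ₁ (x + s)) s := (hℓ (x + s)).comp_const_add x s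
    exact (((h1.sub_const (ℓ x)).sub ((hasDerivAt_id s).const_mul (ℓ₁ x))).add
      ((hasDerivAt_pow 2 s).const_mul (L / 2))).congr_deriv (by norm_num [hψ]; ring)
  -- `ψ` is monotone with `ψ 0 = 0`
  have hψm : Monotone ψ := monotone_of_deriv_nonneg (fun s => (hψd s).differentiableAt) fun s => by
    rw [(hψd s).deriv]; linarith [hL (x + s)]
  have hψ0 : ψ 0 = 0 := by simp [hψ]
  have hφ0 : φ 0 = 0 := by simp [hφ]
  have hφc : Continuous φ := continuous_iff_continuousAt.2 fun s => (hφd s).continuousAt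
  have hderiv : ∀ s, deriv φ s = ψ s := fun s => (hφd s).deriv
  -- `φ ≥ 0` on `[0, ∞)` (monotone there) and on `(-∞, 0]` (antitone there)
  have hφθ : 0 ≤ φ θ := by
    rcases le_total 0 θ with hθ | hθ
    · have hmono : MonotoneOn φ (Set.Ici 0) :=
        monotoneOn_of_deriv_nonneg (convex_Ici 0) hφc.continuousOn
          (fun s _ => (hφd s).differentiableAt.differentiableWithinAt) fun s hs => by
            rw [interior_Ici] at hs
            rw [hderiv, ← hψ0]
            exact hψm (le_of_lt hs)
      simpa [hφ0] using hmono (Set.mem_Ici.2 le_rfl) (Set.mem_Ici.2 hθ) hθ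
    · have hanti : AntitoneOn φ (Set.Iic 0) :=
        antitoneOn_of_deriv_nonpos (convex_Iic 0) hφc.continuousOn
          (fun s _ => (hφd s).differentiableAt.differentiableWithinAt) fun s hs => by
            rw [interior_Iic] at hs
            rw [hderiv, ← hψ0]
            exact hψm (le_of_lt hs)
      simpa [hφ0] using hanti (Set.mem_Iic.2 hθ) (Set.mem_Iic.2 le_rfl) hθ
  have : φ θ = ℓ (x + θ) - ℓ x - ℓ₁ x * θ + L / 2 * θ ^ 2 := rfl
  linarith [hφθ]

/-- **The derivative of an even function is odd** (FS81: "By property (b) of `I_β`, `Ĩ_β = (log I_β)'`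
is an odd function of `φ`"). [cite: FrohlichSpencerKT1981, Sect. 6 (6.28)–(6.29), p. 582] -/
theorem deriv_odd_of_even {ℓ ℓ₁ : ℝ → ℝ} (hℓ : ∀ t, HasDerivAt ℓ (ℓ₁ t) t)
    (heven : ∀ t, ℓ (-t) = ℓ t) (t : ℝ) : ℓ₁ (-t) = -ℓ₁ t := by
  have h1 : HasDerivAt (ℓ ∘ Neg.neg) (ℓ₁ (-t) * -1) t := (hℓ (-t)).comp t (hasDerivAt_neg t)
  have h2 : ℓ ∘ Neg.neg = ℓ := funext fun s => heven s
  rw [h2] at h1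
  have := (hℓ t).unique h1
  linarith

/-! ### The product form (6.28) -/

/-- Summed Taylor lower bound: `∑ ℓ(x_p) + ∑ ℓ₁(x_p)θ_p - (L/2)∑ θ_p² ≤ ∑ ℓ(x_p + θ_p)`.
[cite: FrohlichSpencerKT1981, Sect. 6 (6.28), p. 582] -/
theorem sum_taylor_ge {P : Type*} [Fintype P] {ℓ ℓ₁ ℓ₂ : ℝ → ℝ} {L : ℝ}
    (hℓ : ∀ t, HasDerivAt ℓ (ℓ₁ t) t) (hℓ₁ : ∀ t, HasDerivAt ℓ₁ (ℓ₂ t) t) (hL : ∀ t, -L ≤ ℓ₂ t)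
    (x θ : P → ℝ) :
    ∑ p, ℓ (x p) + ∑ p, ℓ₁ (x p) * θ p - L / 2 * ∑ p, θ p ^ 2 ≤ ∑ p, ℓ (x p + θ p) := by
  have h := fun p => taylor_ge_of_deriv2_ge hℓ hℓ₁ hL (x p) (θ p)
  calc ∑ p, ℓ (x p) + ∑ p, ℓ₁ (x p) * θ p - L / 2 * ∑ p, θ p ^ 2
      = ∑ p, (ℓ (x p) + ℓ₁ (x p) * θ p - L / 2 * θ p ^ 2) := by
        rw [Finset.mul_sum, ← Finset.sum_add_distrib, ← Finset.sum_sub_distrib]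
    _ ≤ ∑ p, ℓ (x p + θ p) := Finset.sum_le_sum fun p _ => h p

/-- **FS81 (6.28) for an abstract weight `W = exp ∘ ℓ` with `ℓ'' ≥ -L`:**
`(∏_p W(x_p)) · exp(∑_p ℓ₁(x_p)θ_p - (L/2)∑_p θ_p²) ≤ ∏_p W(x_p + θ_p)`.
[cite: FrohlichSpencerKT1981, Sect. 6 (6.28), p. 582] -/
theorem prod_exp_translation_ge {P : Type*} [Fintype P] {ℓ ℓ₁ ℓ₂ : ℝ → ℝ} {L : ℝ}
    (hℓ : ∀ t, HasDerivAt ℓ (ℓ₁ t) t) (hℓ₁ : ∀ t, HasDerivAt ℓ₁ (ℓ₂ t) t) (hL : ∀ t, -L ≤ ℓ₂ t)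
    (x θ : P → ℝ) :
    (∏ p, Real.exp (ℓ (x p))) * Real.exp (∑ p, ℓ₁ (x p) * θ p - L / 2 * ∑ p, θ p ^ 2) ≤
      ∏ p, Real.exp (ℓ (x p + θ p)) := by
  rw [← Real.exp_sum, ← Real.exp_sum, ← Real.exp_add]
  exact Real.exp_le_exp.2 (by linarith [sum_taylor_ge hℓ hℓ₁ hL x θ])

/-! ### Symmetrisation: an odd exponent can only increase an even integral -/

section Symmetrisation

variable {G : Type*} [MeasurableSpace G] [AddGroup G] [MeasurableNeg G] (μ : Measure G)
  [μ.IsNegInvariant]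

/-- **Symmetrisation (replacing Jensen in FS81 (6.38)–(6.39)).** For a negation-invariant measure,
`Φ ≥ 0` even and `O` odd with `Φ e^{O}` integrable: `∫ Φ ≤ ∫ Φ e^{O}` — indeed
`∫ Φ e^{O} = ∫ Φ e^{-O} = ∫ Φ cosh O ≥ ∫ Φ`. [cite: FrohlichSpencerKT1981, Sect. 6 (6.38)–(6.39), p. 583] -/
theorem integral_le_integral_mul_exp_odd {Φ O : G → ℝ} (hΦm : AEStronglyMeasurable Φ μ)
    (hΦ0 : ∀ x, 0 ≤ Φ x) (hΦe : ∀ x, Φ (-x) = Φ x)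
    (hO : ∀ x, O (-x) = -O x) (hi : Integrable (fun x => Φ x * Real.exp (O x)) μ) :
    ∫ x, Φ x ∂μ ≤ ∫ x, Φ x * Real.exp (O x) ∂μ := by
  -- the reflected integrand is integrable and has the same integral
  have hi' : Integrable (fun x => Φ x * Real.exp (-O x)) μ := by
    simpa [hΦe, hO] using hi.comp_neg
  have heq : ∫ x, Φ x * Real.exp (-O x) ∂μ = ∫ x, Φ x * Real.exp (O x) ∂μ := by
    rw [← integral_neg_eq_self (fun x => Φ x * Real.exp (O x)) μ]
    simp_rw [hΦe, hO]
  -- `Φ` itself is integrable: `Φ ≤ Φ e^{O} + Φ e^{-O}`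
  have hΦi : Integrable Φ μ := by
    refine (hi.add hi').mono' hΦm (Filter.Eventually.of_forall fun x => ?_)
    rw [Real.norm_eq_abs, abs_of_nonneg (hΦ0 x)]
    simp only [Pi.add_apply]
    have h1 : 0 ≤ Φ x * Real.exp (O x) := mul_nonneg (hΦ0 x) (Real.exp_pos _).le
    have h2 : 0 ≤ Φ x * Real.exp (-O x) := mul_nonneg (hΦ0 x) (Real.exp_pos _).le
    rcases le_total 0 (O x) with h | h
    · have : 1 ≤ Real.exp (O x) := Real.one_le_exp h
      nlinarith [hΦ0 x]
    · have : 1 ≤ Real.exp (-O x) := Real.one_le_exp (by linarith)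
      nlinarith [hΦ0 x]
  -- `2 ∫ Φ ≤ ∫ Φ (e^{O} + e^{-O}) = 2 ∫ Φ e^{O}`
  have hsum : ∫ x, Φ x * Real.exp (O x) ∂μ + ∫ x, Φ x * Real.exp (-O x) ∂μ =
      ∫ x, Φ x * (Real.exp (O x) + Real.exp (-O x)) ∂μ := by
    rw [← integral_add hi hi']
    exact integral_congr_ae (Filter.Eventually.of_forall fun x => by ring)
  have hge : ∫ x, 2 * Φ x ∂μ ≤ ∫ x, Φ x * (Real.exp (O x) + Real.exp (-O x)) ∂μ := by
    refine integral_mono (hΦi.const_mul 2) ?_ fun x => ?_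
    · have := hi.add hi'
      exact this.congr (Filter.Eventually.of_forall fun x => by simp only [Pi.add_apply]; ring)
    · have hc : 2 ≤ Real.exp (O x) + Real.exp (-O x) := by
        have := Real.one_le_cosh (O x)
        rw [Real.cosh_eq] at this
        linarith
      simpa [mul_comm] using mul_le_mul_of_nonneg_left hc (hΦ0 x)
  rw [integral_const_mul] at hge
  linarith

/-- **Symmetrisation with a further bounded-below exponent** (the form of FS81 (6.38)–(6.39): the odd
parts `H₀ + ∑ H_{1,ρ}` drop out, the even remainders `∑ H_{2,ρ} ≥ -δ` cost `e^{-δ}`): for `Φ ≥ 0` even,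
`O` odd and `R ≥ -δ` with `Φ e^{O + R}` integrable, `e^{-δ} ∫ Φ ≤ ∫ Φ e^{O + R}`.
[cite: FrohlichSpencerKT1981, Sect. 6 (6.38)–(6.39) and (6.43)–(6.44), pp. 583–584] -/
theorem integral_le_integral_mul_exp_odd_add {Φ O R : G → ℝ} {δ : ℝ} (hΦm : AEStronglyMeasurable Φ μ)
    (hOm : AEStronglyMeasurable O μ) (hΦ0 : ∀ x, 0 ≤ Φ x) (hΦe : ∀ x, Φ (-x) = Φ x)
    (hO : ∀ x, O (-x) = -O x) (hR : ∀ x, -δ ≤ R x)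
    (hi : Integrable (fun x => Φ x * Real.exp (O x + R x)) μ) :
    Real.exp (-δ) * ∫ x, Φ x ∂μ ≤ ∫ x, Φ x * Real.exp (O x + R x) ∂μ := by
  -- `Φ e^{O} ≤ e^{δ} Φ e^{O+R}`, so `Φ e^{O}` is integrable and the integrals compare
  have hpt : ∀ x, Φ x * Real.exp (O x) ≤ Real.exp δ * (Φ x * Real.exp (O x + R x)) := by
    intro x
    have : Real.exp (O x) ≤ Real.exp δ * Real.exp (O x + R x) := by
      rw [← Real.exp_add]; exact Real.exp_le_exp.2 (by linarith [hR x])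
    calc Φ x * Real.exp (O x) ≤ Φ x * (Real.exp δ * Real.exp (O x + R x)) :=
          mul_le_mul_of_nonneg_left this (hΦ0 x)
      _ = _ := by ring
  have hiO : Integrable (fun x => Φ x * Real.exp (O x)) μ := by
    refine (hi.const_mul (Real.exp δ)).mono' (hΦm.mul (Real.continuous_exp.comp_aestronglyMeasurable hOm))
      (Filter.Eventually.of_forall fun x => ?_)
    rw [Real.norm_eq_abs, abs_of_nonneg (mul_nonneg (hΦ0 x) (Real.exp_pos _).le)]
    exact hpt x
  have h1 := integral_le_integral_mul_exp_odd μ hΦm hΦ0 hΦe hO hiO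
  have h2 : ∫ x, Φ x * Real.exp (O x) ∂μ ≤ Real.exp δ * ∫ x, Φ x * Real.exp (O x + R x) ∂μ := by
    rw [← integral_const_mul]
    exact integral_mono hiO (hi.const_mul _) hpt
  have hδ : 0 < Real.exp (-δ) := Real.exp_pos _
  calc Real.exp (-δ) * ∫ x, Φ x ∂μ ≤ Real.exp (-δ) * (Real.exp δ * ∫ x, Φ x * Real.exp (O x + R x) ∂μ) :=
        mul_le_mul_of_nonneg_left (h1.trans h2) hδ.le
    _ = ∫ x, Φ x * Real.exp (O x + R x) ∂μ := by
        rw [← mul_assoc, ← Real.exp_add, neg_add_cancel, Real.exp_zero, one_mul]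

end Symmetrisation

/-! ### The assembled spin-wave extraction on `ℝ^ι` -/

/-- **Spin-wave extraction for a semi-log-concave even product weight** (FS81 (6.28)–(6.29) with
(6.38)–(6.39); the Wilson-action replacement of FS82 (2.54)). Let `W = exp ∘ ℓ` with `ℓ` even,
`ℓ' = ℓ₁`, `ℓ₁' = ℓ₂ ≥ -L`; let `A : ℝ^ι → ℝ^P` be odd and measurable (e.g. linear: `x ↦ dx`) and
`Φ ≥ 0` even. Then for every translation `θ ∈ ℝ^P`,
`exp(-(L/2) ∑_p θ_p²) · ∫ Φ(x) ∏_p W((Ax)_p) dx ≤ ∫ Φ(x) ∏_p W((Ax)_p + θ_p) dx`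
(provided the right-hand integrand is integrable).
[cite: FrohlichSpencerKT1981, Sect. 6 (6.28)–(6.29), (6.38)–(6.39), pp. 582–583] -/
theorem integral_mul_prod_exp_translation_ge {ι P : Type*} [Fintype ι] [Fintype P]
    {ℓ ℓ₁ ℓ₂ : ℝ → ℝ} {L : ℝ}
    (hℓ : ∀ t, HasDerivAt ℓ (ℓ₁ t) t) (hℓ₁ : ∀ t, HasDerivAt ℓ₁ (ℓ₂ t) t) (hL : ∀ t, -L ≤ ℓ₂ t)
    (heven : ∀ t, ℓ (-t) = ℓ t)
    {A : (ι → ℝ) → P → ℝ} (hA : ∀ x, A (-x) = -A x) (hAm : Measurable A)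
    {Φ : (ι → ℝ) → ℝ} (hΦm : AEStronglyMeasurable Φ volume) (hΦ0 : ∀ x, 0 ≤ Φ x)
    (hΦe : ∀ x, Φ (-x) = Φ x) (θ : P → ℝ)
    (hi : Integrable (fun x => Φ x * ∏ p, Real.exp (ℓ (A x p + θ p)))) :
    Real.exp (-(L / 2) * ∑ p, θ p ^ 2) * ∫ x, Φ x * ∏ p, Real.exp (ℓ (A x p)) ≤
      ∫ x, Φ x * ∏ p, Real.exp (ℓ (A x p + θ p)) := by
  have hℓc : Continuous ℓ := continuous_iff_continuousAt.2 fun t => (hℓ t).continuousAt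
  have hℓ₁c : Continuous ℓ₁ := continuous_iff_continuousAt.2 fun t => (hℓ₁ t).continuousAt
  -- the even weight `Ψ = Φ ∏ W((Ax)_p)` and the odd exponent `O = ∑ ℓ₁((Ax)_p) θ_p`
  set Ψ : (ι → ℝ) → ℝ := fun x => Φ x * ∏ p, Real.exp (ℓ (A x p)) with hΨ
  set O : (ι → ℝ) → ℝ := fun x => ∑ p, ℓ₁ (A x p) * θ p with hO
  set c : ℝ := Real.exp (-(L / 2) * ∑ p, θ p ^ 2) with hc
  have hAp : ∀ p, Measurable fun x => A x p := fun p => (measurable_pi_apply p).comp hAm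
  have hWm : Measurable fun x => ∏ p, Real.exp (ℓ (A x p)) :=
    Finset.measurable_prod _ fun p _ =>
      Real.continuous_exp.measurable.comp (hℓc.measurable.comp (hAp p))
  have hOm : Measurable O :=
    Finset.measurable_sum _ fun p _ => (hℓ₁c.measurable.comp (hAp p)).mul_const (θ p)
  have hΨm : AEStronglyMeasurable Ψ volume := hΦm.mul hWm.aestronglyMeasurable
  have hΨ0 : ∀ x, 0 ≤ Ψ x := fun x =>
    mul_nonneg (hΦ0 x) (Finset.prod_nonneg fun p _ => (Real.exp_pos _).le)
  have hΨe : ∀ x, Ψ (-x) = Ψ x := by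
    intro x
    simp only [hΨ, hΦe, hA, Pi.neg_apply, heven]
  have hOo : ∀ x, O (-x) = -O x := by
    intro x
    simp only [hO, hA, Pi.neg_apply, deriv_odd_of_even hℓ heven, neg_mul, Finset.sum_neg_distrib]
  -- pointwise: `c · Ψ e^{O} ≤ Φ ∏ W((Ax)_p + θ_p)` by (6.28)
  have hc0 : 0 < c := Real.exp_pos _
  have hpt : ∀ x, c * (Ψ x * Real.exp (O x)) ≤ Φ x * ∏ p, Real.exp (ℓ (A x p + θ p)) := by
    intro x
    have h := prod_exp_translation_ge hℓ hℓ₁ hL (A x) θ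
    have hsplit : Real.exp (∑ p, ℓ₁ (A x p) * θ p - L / 2 * ∑ p, θ p ^ 2) = Real.exp (O x) * c := by
      rw [hc, hO, ← Real.exp_add]; congr 1; ring
    rw [hsplit] at h
    calc c * (Ψ x * Real.exp (O x))
        = Φ x * ((∏ p, Real.exp (ℓ (A x p))) * (Real.exp (O x) * c)) := by simp only [hΨ]; ring
      _ ≤ Φ x * ∏ p, Real.exp (ℓ (A x p + θ p)) := mul_le_mul_of_nonneg_left h (hΦ0 x)
  -- integrability of `Ψ e^{O}` (dominated by `c⁻¹` times the translated integrand)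
  have hiΨ : Integrable (fun x => Ψ x * Real.exp (O x)) := by
    refine (hi.const_mul c⁻¹).mono'
      (hΨm.mul (Real.continuous_exp.measurable.comp hOm).aestronglyMeasurable)
      (Filter.Eventually.of_forall fun x => ?_)
    rw [Real.norm_eq_abs, abs_of_nonneg (mul_nonneg (hΨ0 x) (Real.exp_pos _).le)]
    calc Ψ x * Real.exp (O x) = c⁻¹ * (c * (Ψ x * Real.exp (O x))) := by
          rw [← mul_assoc, inv_mul_cancel₀ hc0.ne', one_mul]
      _ ≤ c⁻¹ * (Φ x * ∏ p, Real.exp (ℓ (A x p + θ p))) :=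
          mul_le_mul_of_nonneg_left (hpt x) (inv_nonneg.2 hc0.le)
  -- assemble: `c ∫ Ψ ≤ c ∫ Ψ e^{O} ≤ ∫ Φ ∏ W(· + θ)`
  have h1 : c * ∫ x, Ψ x * Real.exp (O x) ≤ ∫ x, Φ x * ∏ p, Real.exp (ℓ (A x p + θ p)) := by
    rw [← integral_const_mul]
    exact integral_mono (hiΨ.const_mul c) hi hpt
  have h2 : ∫ x, Ψ x ≤ ∫ x, Ψ x * Real.exp (O x) :=
    integral_le_integral_mul_exp_odd volume hΨm hΨ0 hΨe hOo hiΨ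
  calc c * ∫ x, Ψ x ≤ c * ∫ x, Ψ x * Real.exp (O x) := mul_le_mul_of_nonneg_left h2 hc0.le
    _ ≤ _ := h1

end WeightTranslation

end Literature.Probability.LatticeModels
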